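import Literature.NumberTheory.Transcendental.DiazMain
import Literature.NumberTheory.Transcendental.DiazMainIIIOfCriterion
import Literature.NumberTheory.Transcendental.DiazMainIIOfCriterion
import HarnessLib

/-!
# Discharges of named facts of `DiazGrid.lean`

`Literature/NumberTheory/Transcendental/DiazGridHolds.lean` — proofs-only sibling of
`DiazGrid.lean` (no definitions, no named facts). Each theorem below closes a named fact `X :
Prop` of that file as `X_holds : X` by composing an ACCEPTED reduction theorem of the tree
with the ACCEPTED unconditional `_holds` discharges of all of its hypotheses; nothing is
re-proved and no statement is changed. Recorded by the librarian sweep g25 (2026-08-16, pass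
5c: facts dischargeable in one line from the tree's own lemmas), so that the facts census,
`#h21_route_deps` and the cone guardrail see these facts as theorems.

Discharged here:

* `Diaz1989_gridX_holds` := `Diaz1989_gridX_of_main` `Diaz1989_main_ii_holds`
  (`DiazMain.lean`).
* `Diaz1989_gridXY_holds` := `Diaz1989_gridXY_of_main` `Diaz1989_main_iii_holds`
  (`DiazMain.lean`).

## References

* [Diaz1989] — see `lean/references.bib` and the docstring of the fact in `DiazGrid.lean`.
* [NesterenkoPhilippon2001] — see `lean/references.bib` and the docstring of the fact in `DiazGrid.lean`.
-/

namespace Literature.NumberTheory.Transcendental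

/-- **Discharge of the named fact `Diaz1989_gridX`** (`DiazGrid.lean`): Diaz's theorem on the `d ×
ℓ` grid, bound for `t₁ = trdeg K(x₁,…,x_d)` (Diaz 1989, main theorem; Nesterenko–Philippon
(eds.) 2001, Ch. 14, Theorem 2.7, second conclusion with the Remark): … — obtained as
`Diaz1989_gridX_of_main` applied to the tree's unconditional discharge
`Diaz1989_main_ii_holds` of its hypothesis (reduction in `DiazMain.lean`).
[cite: Diaz1989, main theorem (= NesterenkoPhilippon2001 Ch. 14 Thm 2.7, bound for t₁)]
[cite: NesterenkoPhilippon2001, Ch. 14 Thm 2.7 + Remark, p. 248] -/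
theorem Diaz1989_gridX_holds :
    Diaz1989_gridX :=
  Diaz1989_gridX_of_main Diaz1989_main_ii_holds

/-- **Discharge of the named fact `Diaz1989_gridXY`** (`DiazGrid.lean`): Diaz's theorem on the `d
× ℓ` grid, bound for `t₂ = trdeg K(x₁,…,x_d,y₁,…,y_ℓ)` (Diaz 1989; Nesterenko–Philippon (eds.)
2001, Ch. 14, Theorem 2.7, third conclusion; this non-strict bound is already Philippon's 1986
result): … — obtained as `Diaz1989_gridXY_of_main` applied to the tree's unconditional
discharge `Diaz1989_main_iii_holds` of its hypothesis (reduction in `DiazMain.lean`).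
[cite: Diaz1989, main theorem (= NesterenkoPhilippon2001 Ch. 14 Thm 2.7, bound for t₂)]
[cite: NesterenkoPhilippon2001, Ch. 14 Thm 2.7, p. 248] -/
theorem Diaz1989_gridXY_holds :
    Diaz1989_gridXY :=
  Diaz1989_gridXY_of_main Diaz1989_main_iii_holds

end Literature.NumberTheory.Transcendental
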